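import Summits.BirchSwinnertonDyer.BirchSwinnertonDyer.Theorems.KatoDescentTamePotSupersingularTameFineSelmerCongruenceRoad
import Summits.BirchSwinnertonDyer.BirchSwinnertonDyer.Theorems.KatoDescentTamePotSupersingularTameUpperReducibleLargeP
import HarnessLib

/-!
# Route `KatoDescentTamePotSupersingular` (rung K8, sub-rung B4 (t′), cell `bsd-potss`): U₀ = item
# stmt-BirchSwinnertonDyer-19982 `TameUpperDefectRankZero` and its children 19202 / 19413 BY NAME from route items,
# named published facts and the TWO explicit per-row residues — the U₀ bill after this seat's g0–g4
# (a `--supports … --as helper` file; seat `bsd-potss-k8t-c4` g4; nothing booked, BSD not proved by any of this)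

The «find: 19982» answer in ONE theorem (§3): the parent U₀ node holds granted
* route items: `TameLowerHalfRankZero` (19981, crux L₀), `TameRankOne` (19984, residual), `ReducibleKatoMember`
  (19196, crux M), `KatoTamagawaExactInputs` (19191), `PublishedInputsFineSelmerCM` (19387), `PublishedInputsTame` (19198);
* named published facts not (yet) route items: the Heegner-road schemata (Gross–Zagier, Kolyvagin, Matar–Nekovář
  Thm. 0.3), `exists_isNewformOf` (modularity as a newform), Bump–Friedberg–Hoffstein, Lim–Sujatha 2018 Prop. 3.2
  (`LimSujatha2018.prop32_…`, p445851), Mazur 1977 Thm. (7') (order form), the Ogg–Saito schema;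
* residue 1 (`hcert`): on each ♯ row of the Conj-A crux 19413 (non-CM, `W[p]` irreducible, `ρ̄` not onto,
  `p ∣ ∏c_ℓ` or no Manin-clean parametrisation) ONE congruent elliptic curve carrying (A) or finite
  `Sel_{p^∞}[p]` over `ℚ^cyc` (this seat's `TameFineSelmerCongruence.*`, k9-c4's ordinary anchors);
* residue 2 (`hodd7`): the upper half on the reducible (t′) rank-`0` rows with `ord_p #Ш_an` ODD at `p ∈ {3,5,7}`
  (BSD-empty; closes through the exact count at Kato's member) — this seat's `TameUpperReducibleMazurNodes.*`.
§1 is the U₀-ns child 19202 by name from the Heegner road + ♯ certificates (the R100 `closes` term, certified against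
the route decls), §2 the Conj-A crux 19413 by name from per-row mixed certificates (k9-c4's route-free theorem read
against the decl). CONDITIONAL throughout (audit `proof.conditional`); NO item is closed.

References: [LimSujatha2018] §3 Prop. 3.2; [Kato2004Asterisque] Thm. 12.6 (p. 222), Thm. 14.5 (3) (p. 236),
Prop. 14.16 (2) (p. 244); [Mazur1977] Thm. (7'); [GrossZagier1986]; [Kolyvagin1990]; [MatarNekovar2019] Thm. 0.3;
[CoatesSujatha2005] Conj. A; [Cassels1965ArithmeticVIII]; [Miller2011LMS] Def. 1.1.
-/

set_option autoImplicit false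
-- sibling precedent (`KatoDescentTamePotSupersingularAssembly.lean`): the directory name repeats the summit name
set_option linter.dupNamespace false

noncomputable section

open scoped Classical

namespace Summit.BirchSwinnertonDyer.BirchSwinnertonDyer.Theorems

open WeierstrassCurve Literature.NumberTheory.EllipticCurves
  Literature.NumberTheory.EllipticCurves.ModularForms
  Literature.NumberTheory.EllipticCurves.Rank1Residual
  Literature.NumberTheory.EllipticCurves.Rank1Residual.Typed
  Summit.BirchSwinnertonDyer.Rank1Residual
  Summit.BirchSwinnertonDyer.Rank1Residual.Additive
  Summit.BirchSwinnertonDyer.Rank1Residual.O6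
  Summit.BirchSwinnertonDyer.BirchSwinnertonDyer.Theses.KatoDescentTamePotSupersingular

/-! ## §1 Item 19202 `TameUpperNonsurjTower` BY NAME: Heegner road on ♭ rows, congruent anchors on ♯ rows -/

/-- **Item 19202 `TameUpperNonsurjTower` (type = the route decl) from the Heegner-road published inputs, the
route items 19191 / 19387 / 19981 / 19984, Lim–Sujatha and ONE mixed congruent certificate per ♯ row** — the
route-free `TameFineSelmerCongruence.upperNonsurjTower_of_lower_of_rankOne_of_sharpCertificates` read against
the route decls (all unfold definitionally). The certified shape of the R100 `closes` term. Conditional; the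
item is NOT closed. [cite: LimSujatha2018, §3 Prop. 3.2] [cite: MatarNekovar2019, Thm. 0.3]
[cite: Kato2004Asterisque, Thm. 14.5 (3) (p. 236), Prop. 14.16 (2) (p. 244)] -/
theorem tameUpperNonsurjTower_of_lower_of_rankOne_of_sharpCertificates
    (hGZ : ∀ (N : ℕ) [NeZero N] (W : WeierstrassCurve ℚ) (K : Type) [Field K] [NumberField K],
      gross_zagier N W K)
    (hKo : ∀ (N : ℕ) [NeZero N] (W : WeierstrassCurve ℚ) (K : Type) [Field K] [NumberField K],
      kolyvagin N W K)
    (hMN : ∀ (N : ℕ) [NeZero N] (W : WeierstrassCurve ℚ) (K : Type) [Field K] [NumberField K],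
      MatarNekovar2019.thm03_padicValNat_card_sha_le_of_irreducible N W K)
    (hnf : exists_isNewformOf) (hBFH : bumpFriedbergHoffstein_exists_heegnerField_split_twist_simpleZero)
    (hK : KatoTamagawaExactInputs) (hF : PublishedInputsFineSelmerCM) (h₂ : TameLowerHalfRankZero)
    (hR : TameRankOne) (hLS : LimSujatha2018.prop32_fineSelmerDual_moduleFinite_iff_of_torsionIso)
    (hcert : ∀ (W : WeierstrassCurve ℚ) [W.IsElliptic] [W.IsGloballyMinimal] (p : ℕ) [Fact p.Prime],
      W.analyticRank = 0 → p ≠ 2 → Addv W p → SubTprime W p → ¬ W.HasCM →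
      W.HasIrreducibleModPGaloisRep p → ¬ W.HasSurjectiveModNGaloisRep p →
      (p ∣ W.tamagawaProduct ∨ ∀ [NeZero (W.conductorNorm ℤ)]
        (D : ModularParametrizationData W (W.conductorNorm ℤ)), (p : ℤ) ∣ D.c) →
      ∃ (W' : WeierstrassCurve ℚ) (_ : W'.IsElliptic), ModPCongruent W' W p ∧
        ((∀ (κ : ZpExtension ℚ p), κ.IsCyclotomic →
            ∃ (γ : Field.absoluteGaloisGroup ℚ) (D : W'.FineSelmerDualData κ γ),
              Module.Finite ℤ_[p] (RestrictScalars ℤ_[p] (IwasawaAlgebra p) D.X)) ∨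
          ∀ (κ : ZpExtension ℚ p), κ.IsCyclotomic → Set.Finite {s : W'.selmerInfty κ | p • s = 0})) :
    Summit.BirchSwinnertonDyer.BirchSwinnertonDyer.Theses.KatoDescentTamePotSupersingular.TameUpperNonsurjTower :=
  TameFineSelmerCongruence.upperNonsurjTower_of_lower_of_rankOne_of_sharpCertificates hGZ hKo hMN hnf hBFH hK hF
    h₂ hR hLS hcert

/-! ## §2 Item 19413 `TameFineSelmerCoatesSujatha` BY NAME from per-row mixed certificates -/

/-- **Item 19413 `TameFineSelmerCoatesSujatha` (type = the route decl) from Lim–Sujatha and ONE mixed congruent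
certificate per row** — k9-c4's route-free `TameFineSelmerOrdinaryAnchor.tameFineSelmerCoatesSujatha_of_mixedCertificates`
read against the decl (definitional unfolding). Conditional; the item is NOT closed.
[cite: LimSujatha2018, §3 Prop. 3.2] [cite: GreenbergVatsal2000, §2 Prop. (2.8)] [cite: CoatesSujatha2005, Conjecture A] -/
theorem tameFineSelmerCoatesSujatha_of_mixedCertificates_typed
    (hLS : LimSujatha2018.prop32_fineSelmerDual_moduleFinite_iff_of_torsionIso)
    (hcert : ∀ (W : WeierstrassCurve ℚ) [W.IsElliptic] [W.IsGloballyMinimal] (p : ℕ) [Fact p.Prime],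
      W.analyticRank = 0 → p ≠ 2 → Addv W p → SubTprime W p → W.HasIrreducibleModPGaloisRep p →
      ¬ (∀ n : ℕ, W.HasSurjectiveModNGaloisRep (p ^ n : ℕ)) → ¬ W.HasCM →
      ∃ (W' : WeierstrassCurve ℚ) (_ : W'.IsElliptic), ModPCongruent W' W p ∧
        ((∀ (κ : ZpExtension ℚ p), κ.IsCyclotomic →
            ∃ (γ : Field.absoluteGaloisGroup ℚ) (D : W'.FineSelmerDualData κ γ),
              Module.Finite ℤ_[p] (RestrictScalars ℤ_[p] (IwasawaAlgebra p) D.X)) ∨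
          ∀ (κ : ZpExtension ℚ p), κ.IsCyclotomic → Set.Finite {s : W'.selmerInfty κ | p • s = 0})) :
    Summit.BirchSwinnertonDyer.BirchSwinnertonDyer.Theses.KatoDescentTamePotSupersingular.TameFineSelmerCoatesSujatha :=
  TameFineSelmerOrdinaryAnchor.tameFineSelmerCoatesSujatha_of_mixedCertificates hLS hcert

/-! ## §3 Item 19982 `TameUpperDefectRankZero` BY NAME — the U₀ bill after g4 -/

/-- **U₀ of K8-t′ — item 19982 `TameUpperDefectRankZero` (type = the route decl) — from route items, named
published facts and the TWO per-row residues.** Route items: `KatoTamagawaExactInputs` (`hK`),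
`PublishedInputsFineSelmerCM` (`hF`), `TameLowerHalfRankZero` (`h₂`), `TameRankOne` (`hR`), `ReducibleKatoMember`
(`h₃`), `PublishedInputsTame` (`hP`). Named facts: the Heegner-road schemata (`hGZ hKo hMN`), `exists_isNewformOf`
(`hnf`), Bump–Friedberg–Hoffstein (`hBFH`), Lim–Sujatha (`hLS`), Mazur Thm. (7') order form (`hMz`), the Ogg–Saito
schema (`hOS`). Residues: `hcert` (one mixed congruent certificate per ♯ row of 19413) and `hodd7` (the upper
half on the odd-parity reducible (t′) rank-`0` rows at `p ≤ 7`). Proof: the proved split glue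
(`tameUpperDefectOfSplit_proof`, item 19204) applied to §1 and to this seat's
`tameUpperReducibleDefect_of_reducibleKatoMember_of_mazur_of_oggSaito_of_oddParityLeSeven` (p446379).
Conditional on every displayed hypothesis; NO item is closed; BSD is not proved by any of this.
[cite: LimSujatha2018, §3 Prop. 3.2] [cite: Mazur1977, Thm. (7') p. 35]
[cite: Kato2004Asterisque, Thm. 12.6 (p. 222), Thm. 14.5 (3) (p. 236), Prop. 14.16 (2) (p. 244)]
[cite: CoatesSujatha2005, Conjecture A] [cite: Cassels1965ArithmeticVIII] -/
theorem tameUpperDefectRankZero_bill_of_sharpCertificates_of_oddParityLeSeven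
    (hGZ : ∀ (N : ℕ) [NeZero N] (W : WeierstrassCurve ℚ) (K : Type) [Field K] [NumberField K],
      gross_zagier N W K)
    (hKo : ∀ (N : ℕ) [NeZero N] (W : WeierstrassCurve ℚ) (K : Type) [Field K] [NumberField K],
      kolyvagin N W K)
    (hMN : ∀ (N : ℕ) [NeZero N] (W : WeierstrassCurve ℚ) (K : Type) [Field K] [NumberField K],
      MatarNekovar2019.thm03_padicValNat_card_sha_le_of_irreducible N W K)
    (hnf : exists_isNewformOf) (hBFH : bumpFriedbergHoffstein_exists_heegnerField_split_twist_simpleZero)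
    (hK : KatoTamagawaExactInputs) (hF : PublishedInputsFineSelmerCM) (h₂ : TameLowerHalfRankZero)
    (hR : TameRankOne) (hLS : LimSujatha2018.prop32_fineSelmerDual_moduleFinite_iff_of_torsionIso)
    (hcert : ∀ (W : WeierstrassCurve ℚ) [W.IsElliptic] [W.IsGloballyMinimal] (p : ℕ) [Fact p.Prime],
      W.analyticRank = 0 → p ≠ 2 → Addv W p → SubTprime W p → ¬ W.HasCM →
      W.HasIrreducibleModPGaloisRep p → ¬ W.HasSurjectiveModNGaloisRep p →
      (p ∣ W.tamagawaProduct ∨ ∀ [NeZero (W.conductorNorm ℤ)]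
        (D : ModularParametrizationData W (W.conductorNorm ℤ)), (p : ℤ) ∣ D.c) →
      ∃ (W' : WeierstrassCurve ℚ) (_ : W'.IsElliptic), ModPCongruent W' W p ∧
        ((∀ (κ : ZpExtension ℚ p), κ.IsCyclotomic →
            ∃ (γ : Field.absoluteGaloisGroup ℚ) (D : W'.FineSelmerDualData κ γ),
              Module.Finite ℤ_[p] (RestrictScalars ℤ_[p] (IwasawaAlgebra p) D.X)) ∨
          ∀ (κ : ZpExtension ℚ p), κ.IsCyclotomic → Set.Finite {s : W'.selmerInfty κ | p • s = 0}))
    (h₃ : ReducibleKatoMember) (hMz : ∀ (V : WeierstrassCurve ℚ), Mazur1977_addOrderOf_le V)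
    (hOS : ∀ (V : WeierstrassCurve ℚ) (ℓ : ℕ) [Fact ℓ.Prime],
      V.artinConductorExponent_tate_eq_conductorExponent_of_isElliptic ℓ)
    (hP : PublishedInputsTame)
    (hodd7 : ∀ (W : WeierstrassCurve ℚ) [W.IsElliptic] [W.IsGloballyMinimal] (p : ℕ) [Fact p.Prime],
      p ≤ 7 → W.analyticRank = 0 → p ≠ 2 → Addv W p → SubTprime W p → ¬ W.HasIrreducibleModPGaloisRep p →
      (∃ q : ℚ, shaAn W = (q : ℂ) ∧ ¬ Even (padicValRat p q)) → MissingUpperBoundAt W p) :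
    Summit.BirchSwinnertonDyer.BirchSwinnertonDyer.Theses.KatoDescentTamePotSupersingular.TameUpperDefectRankZero :=
  tameUpperDefectOfSplit_proof
    (tameUpperNonsurjTower_of_lower_of_rankOne_of_sharpCertificates hGZ hKo hMN hnf hBFH hK hF h₂ hR hLS hcert)
    (tameUpperReducibleDefect_of_reducibleKatoMember_of_mazur_of_oggSaito_of_oddParityLeSeven h₃ hMz hOS hP hodd7) hK

end Summit.BirchSwinnertonDyer.BirchSwinnertonDyer.Theorems

end
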